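import Summits.QuantumFields.QCD.Theorems.HeatSlicedQuarksSmallFieldUltracontractivityBootHopping

/-!
# Stub `stub_hoppingWeightedBounds` of line `Sketch`
(crux `Summit.QuantumFields.QCD.Theses.HeatSlicedQuarks.InterleavedHeatSliceFlow`, item stmt-QuantumFields-8891)

**Weighted Schur bounds for the hopping perturbation** `E = D_W(W) − D_W(1)` of an `SU(3)` gauge
field `W` on the four-torus whose link deficits grow at most quadratically with the distance from a
centre `x`: `3 − Re tr W(z,μ) ≤ C_A (d(x,z)+1)² δ²` (`δ ≥ 0`).  With `C = 9216 (C_A+1)²`, for every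
vector `v`,

* `Σ_q ‖(E v)_q‖² ≤ C δ² Σ_q (d(x,q)+3)² ‖v_q‖²`,
* `Σ_q ‖(Eᴴ v)_q‖² ≤ C δ² Σ_q (d(x,q)+3)² ‖v_q‖²`,
* `Σ_q ‖(Eᴴ v)_q‖ ≤ C δ Σ_q (d(x,q)+3) ‖v_q‖`.

Proof.  By `norm_sub_one_apply_le_of_deficit` (module `…SmallFieldUltracontractivityBootHopping`)
and `C_A ≤ (C_A+1)²/2`, every colour block `ρW(z,μ) − 1`, `ρW(z,μ)⁻¹ − 1` has entries of modulus
`≤ (C_A+1) δ (d(x,z)+1)`.  The entry bound `norm_hopping_apply_le` of the same module then gives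
`|E_{pq}| ≤ (C_A+1) δ (d(x,q)+3) N_{pq}` and `|(Eᴴ)_{pq}| = |E_{qp}| ≤ (C_A+1) δ (d(x,q)+3) N_{pq}`,
where `N_{pq} = Σ_μ ([q = p+μ̂] + [p = q+μ̂])` is the symmetric nearest-neighbour majorant (the
links entering `E_{pq}` are based at `p` or at `q`, both at distance `≤ d(x,q)+1` from `x`), whose
rows and columns sum to `96 = 2·4·12`.  The three bounds are then the weighted Schur test:
Cauchy–Schwarz in each row with the weights `N_{pq}`, followed by an exchange of the order of
summation.  No named facts are used.
-/

noncomputable section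

namespace Summit.QuantumFields.QCD.Cruxes.InterleavedHeatSliceFlow.Sketch

open Literature.MathematicalPhysics.QuantumLattice Literature.MathematicalPhysics.QuantumFieldTheory
open Literature.Probability.LatticeModels
open Summit.QuantumFields.QCD.Theses.HeatSlicedQuarks
open Summit.QuantumFields.QCD.Cruxes.SmallFieldUltracontractivity.PointCentredAxialParabolic
open Summit.QuantumFields.QCD.Theorems.SmallFieldUltracontractivity.Negative
open Summit.QuantumFields.QCD.Theorems.HeatSlicedQuarksDaviesGaffney
open scoped Matrix

/-! ### The weighted Schur test -/

section Schur

variable {ι : Type*} [Fintype ι]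

/-- `‖(F v)_p‖ ≤ Σ_q ‖F_{pq}‖ ‖v_q‖`. -/
private theorem norm_mulVec_apply_le (F : Matrix ι ι ℂ) (v : ι → ℂ) (p : ι) :
    ‖(F *ᵥ v) p‖ ≤ ∑ q, ‖F p q‖ * ‖v q‖ := by
  simp only [Matrix.mulVec, dotProduct]
  exact (norm_sum_le _ _).trans (le_of_eq (Finset.sum_congr rfl fun q _ => norm_mul _ _))

/-- **Weighted Schur test, `ℓ¹` form.**  If `|F_{pq}| ≤ c u_q N_{pq}` (`c, u ≥ 0`) with a kernel
`N` whose columns sum to at most `S`, then `Σ_p ‖(F v)_p‖ ≤ S c Σ_q u_q ‖v_q‖`. -/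
private theorem schur_sum_norm_mulVec_le (F : Matrix ι ι ℂ) (N : ι → ι → ℝ) (u : ι → ℝ)
    {S c : ℝ} (hc : 0 ≤ c) (hu : ∀ q, 0 ≤ u q) (hcol : ∀ q, ∑ p, N p q ≤ S)
    (hF : ∀ p q, ‖F p q‖ ≤ c * u q * N p q) (v : ι → ℂ) :
    ∑ p, ‖(F *ᵥ v) p‖ ≤ S * c * ∑ q, u q * ‖v q‖ := by
  calc ∑ p, ‖(F *ᵥ v) p‖ ≤ ∑ p, ∑ q, c * u q * N p q * ‖v q‖ :=
        Finset.sum_le_sum fun p _ => (norm_mulVec_apply_le F v p).trans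
          (Finset.sum_le_sum fun q _ => mul_le_mul_of_nonneg_right (hF p q) (norm_nonneg _))
    _ = ∑ q, (∑ p, N p q) * (c * (u q * ‖v q‖)) := by
        rw [Finset.sum_comm]
        refine Finset.sum_congr rfl fun q _ => ?_
        rw [Finset.sum_mul]
        exact Finset.sum_congr rfl fun p _ => by ring
    _ ≤ ∑ q, S * (c * (u q * ‖v q‖)) :=
        Finset.sum_le_sum fun q _ => mul_le_mul_of_nonneg_right (hcol q)
          (mul_nonneg hc (mul_nonneg (hu q) (norm_nonneg _)))
    _ = S * c * ∑ q, u q * ‖v q‖ := by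
        rw [Finset.mul_sum]
        exact Finset.sum_congr rfl fun q _ => by ring

/-- **Weighted Schur test, `ℓ²` form.**  If `|F_{pq}| ≤ c u_q N_{pq}` with a nonnegative kernel
`N` whose rows and columns sum to at most `S ≥ 0`, then `Σ_p ‖(F v)_p‖² ≤ S² c² Σ_q u_q² ‖v_q‖²`
(Cauchy–Schwarz in each row with the weights `N_{pq}`, then exchange of the summations). -/
private theorem schur_sum_norm_sq_mulVec_le (F : Matrix ι ι ℂ) (N : ι → ι → ℝ) (u : ι → ℝ)
    {S c : ℝ} (hS : 0 ≤ S) (hN : ∀ p q, 0 ≤ N p q) (hrow : ∀ p, ∑ q, N p q ≤ S)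
    (hcol : ∀ q, ∑ p, N p q ≤ S) (hF : ∀ p q, ‖F p q‖ ≤ c * u q * N p q) (v : ι → ℂ) :
    ∑ p, ‖(F *ᵥ v) p‖ ^ 2 ≤ S ^ 2 * c ^ 2 * ∑ q, u q ^ 2 * ‖v q‖ ^ 2 := by
  have key : ∀ p, ‖(F *ᵥ v) p‖ ^ 2 ≤ S * ∑ q, N p q * (c * u q * ‖v q‖) ^ 2 := by
    intro p
    have h1 : ‖(F *ᵥ v) p‖ ≤ ∑ q, N p q * (c * u q * ‖v q‖) :=
      (norm_mulVec_apply_le F v p).trans (Finset.sum_le_sum fun q _ =>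
        (mul_le_mul_of_nonneg_right (hF p q) (norm_nonneg _)).trans_eq (by ring))
    have h2 : (∑ q, N p q * (c * u q * ‖v q‖)) ^ 2 ≤
        (∑ q, N p q) * ∑ q, N p q * (c * u q * ‖v q‖) ^ 2 :=
      Finset.sum_sq_le_sum_mul_sum_of_sq_le_mul _ (fun q _ => hN p q)
        (fun q _ => mul_nonneg (hN p q) (sq_nonneg _)) (fun q _ => le_of_eq (by ring))
    calc ‖(F *ᵥ v) p‖ ^ 2 ≤ (∑ q, N p q * (c * u q * ‖v q‖)) ^ 2 :=
          pow_le_pow_left₀ (norm_nonneg _) h1 2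
      _ ≤ (∑ q, N p q) * ∑ q, N p q * (c * u q * ‖v q‖) ^ 2 := h2
      _ ≤ S * ∑ q, N p q * (c * u q * ‖v q‖) ^ 2 :=
          mul_le_mul_of_nonneg_right (hrow p)
            (Finset.sum_nonneg fun q _ => mul_nonneg (hN p q) (sq_nonneg _))
  calc ∑ p, ‖(F *ᵥ v) p‖ ^ 2 ≤ ∑ p, S * ∑ q, N p q * (c * u q * ‖v q‖) ^ 2 :=
        Finset.sum_le_sum fun p _ => key p
    _ = S * ∑ q, (∑ p, N p q) * (c * u q * ‖v q‖) ^ 2 := by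
        rw [← Finset.mul_sum, Finset.sum_comm]
        congr 1
        exact Finset.sum_congr rfl fun q _ => by rw [Finset.sum_mul]
    _ ≤ S * ∑ q, S * (c * u q * ‖v q‖) ^ 2 :=
        mul_le_mul_of_nonneg_left
          (Finset.sum_le_sum fun q _ => mul_le_mul_of_nonneg_right (hcol q) (sq_nonneg _)) hS
    _ = S ^ 2 * c ^ 2 * ∑ q, u q ^ 2 * ‖v q‖ ^ 2 := by
        rw [Finset.mul_sum, Finset.mul_sum]
        exact Finset.sum_congr rfl fun q _ => by ring

end Schur

/-! ### Link smallness, the nearest-neighbour majorant, and the entry bounds of `E` and `Eᴴ` -/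

section Hopping

variable {L : ℕ}

/-- One step along a link costs at most one unit of distance from the centre:
if `t = s + μ̂` then `d(x,s) ≤ d(x,t) + 1` (as real numbers). -/
private theorem cast_torusDist_le_of_eq_shift [NeZero L] (x : TorusSite 4 L) {s t : TorusSite 4 L}
    {μ : Fin 4} (h : t = Site.shift s μ) : (torusDist x s : ℝ) ≤ torusDist x t + 1 := by
  have h1 : torusDist t s ≤ 1 := by rw [h]; exact torusDist_shift_self_le s μ
  have h2 := torusDist_triangle' x t s
  have h3 : torusDist x s ≤ torusDist x t + 1 := by omega
  exact_mod_cast h3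

/-- **Link smallness from the deficit profile.**  Under `3 − Re tr W(z,μ) ≤ C_A (d(x,z)+1)² δ²`
(and `C_A ≤ (C_A+1)²/2`), every entry of `ρW(z,μ) − 1` and of `ρW(z,μ)⁻¹ − 1` has modulus at
most `(C_A+1) δ (d(x,z)+1)` (`norm_sub_one_apply_le_of_deficit`). -/
private theorem norm_link_sub_one_le (W : GaugeConfig 4 L SU3) (x : TorusSite 4 L) {C_A δ : ℝ}
    (hC : 0 ≤ C_A) (hδ : 0 ≤ δ)
    (hdef : ∀ (z : TorusSite 4 L) (μ : Fin 4),
      3 - ((fundamentalRep (Fin 3)) (W (z, μ))).trace.re ≤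
        C_A * ((torusDist x z : ℝ) + 1) ^ 2 * δ ^ 2)
    (z : TorusSite 4 L) (μ : Fin 4) (a b : Fin 3) :
    ‖(fundamentalRep (Fin 3) (W (z, μ)) - 1) a b‖ ≤ (C_A + 1) * δ * ((torusDist x z : ℝ) + 1) ∧
      ‖(fundamentalRep (Fin 3) (W (z, μ))⁻¹ - 1) a b‖ ≤
        (C_A + 1) * δ * ((torusDist x z : ℝ) + 1) := by
  refine norm_sub_one_apply_le_of_deficit (W (z, μ)) (by positivity) ((hdef z μ).trans ?_) a b
  have h1 : C_A ≤ (C_A + 1) ^ 2 / 2 := by nlinarith [sq_nonneg C_A]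
  have h2 : (0 : ℝ) ≤ ((torusDist x z : ℝ) + 1) ^ 2 * δ ^ 2 := by positivity
  calc C_A * ((torusDist x z : ℝ) + 1) ^ 2 * δ ^ 2
      = C_A * (((torusDist x z : ℝ) + 1) ^ 2 * δ ^ 2) := by ring
    _ ≤ (C_A + 1) ^ 2 / 2 * (((torusDist x z : ℝ) + 1) ^ 2 * δ ^ 2) :=
        mul_le_mul_of_nonneg_right h1 h2
    _ = ((C_A + 1) * δ * ((torusDist x z : ℝ) + 1)) ^ 2 / 2 := by ring

/-- **Entry bound of `E`** with the site weight of the column index: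
`|E_{pq}| ≤ c (d(x,q)+3) N_{pq}`, `N_{pq} = Σ_μ ([q = p+μ̂] + [p = q+μ̂])`, whenever all colour
blocks based at `z` are `c (d(x,z)+1)`-close to `1` (the links entering `E_{pq}` are based at `p`
or at `q`, and `d(x,p) ≤ d(x,q) + 1` for neighbours). -/
private theorem norm_hopping_apply_le_weight [NeZero L] (W : GaugeConfig 4 L SU3) (m : ℝ)
    (x : TorusSite 4 L) {c : ℝ} (hc : 0 ≤ c)
    (hlink : ∀ (z : TorusSite 4 L) (μ : Fin 4) (a b : Fin 3),
      ‖(fundamentalRep (Fin 3) (W (z, μ)) - 1) a b‖ ≤ c * ((torusDist x z : ℝ) + 1) ∧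
        ‖(fundamentalRep (Fin 3) (W (z, μ))⁻¹ - 1) a b‖ ≤ c * ((torusDist x z : ℝ) + 1))
    (p q : TorusSite 4 L × Fin 3 × Fin 4) :
    ‖(wilsonDirac (fundamentalRep (Fin 3)) W m 1 -
        wilsonDirac (fundamentalRep (Fin 3)) (freeCfg L) m 1) p q‖ ≤
      c * ((torusDist x q.1 : ℝ) + 3) * ∑ μ : Fin 4,
        ((if q.1 = Site.shift p.1 μ then (1 : ℝ) else 0) +
          (if p.1 = Site.shift q.1 μ then (1 : ℝ) else 0)) := by
  refine (norm_hopping_apply_le W m p q (lam := c * ((torusDist x q.1 : ℝ) + 3)) ?_ ?_).trans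
    (le_of_eq ?_)
  · intro μ h a b
    have hd := cast_torusDist_le_of_eq_shift x h
    exact (hlink p.1 μ a b).1.trans (mul_le_mul_of_nonneg_left (by linarith) hc)
  · intro μ _ a b
    exact (hlink q.1 μ a b).2.trans (mul_le_mul_of_nonneg_left (by linarith) hc)
  · rw [Finset.mul_sum, Finset.mul_sum]
    exact Finset.sum_congr rfl fun μ _ => by split_ifs <;> ring

/-- **Entry bound of `Eᴴ`** with the site weight of the column index:
`|(Eᴴ)_{pq}| = |E_{qp}| ≤ c (d(x,q)+3) N_{pq}` under the same link hypothesis. -/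
private theorem norm_hopping_conjTranspose_apply_le_weight [NeZero L] (W : GaugeConfig 4 L SU3)
    (m : ℝ) (x : TorusSite 4 L) {c : ℝ} (hc : 0 ≤ c)
    (hlink : ∀ (z : TorusSite 4 L) (μ : Fin 4) (a b : Fin 3),
      ‖(fundamentalRep (Fin 3) (W (z, μ)) - 1) a b‖ ≤ c * ((torusDist x z : ℝ) + 1) ∧
        ‖(fundamentalRep (Fin 3) (W (z, μ))⁻¹ - 1) a b‖ ≤ c * ((torusDist x z : ℝ) + 1))
    (p q : TorusSite 4 L × Fin 3 × Fin 4) :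
    ‖(wilsonDirac (fundamentalRep (Fin 3)) W m 1 -
        wilsonDirac (fundamentalRep (Fin 3)) (freeCfg L) m 1)ᴴ p q‖ ≤
      c * ((torusDist x q.1 : ℝ) + 3) * ∑ μ : Fin 4,
        ((if q.1 = Site.shift p.1 μ then (1 : ℝ) else 0) +
          (if p.1 = Site.shift q.1 μ then (1 : ℝ) else 0)) := by
  rw [Matrix.conjTranspose_apply, norm_star]
  refine (norm_hopping_apply_le W m q p (lam := c * ((torusDist x q.1 : ℝ) + 3)) ?_ ?_).trans
    (le_of_eq ?_)
  · intro μ _ a b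
    exact (hlink q.1 μ a b).1.trans (mul_le_mul_of_nonneg_left (by linarith) hc)
  · intro μ h a b
    have hd := cast_torusDist_le_of_eq_shift x h
    exact (hlink p.1 μ a b).2.trans (mul_le_mul_of_nonneg_left (by linarith) hc)
  · rw [Finset.mul_sum, Finset.mul_sum]
    exact Finset.sum_congr rfl fun μ _ => by split_ifs <;> ring

/-- Row sums of the nearest-neighbour majorant: `Σ_q N_{pq} = 96` (`2·4` neighbours times the
`12`-dimensional colour–spin fibre, `sum_ite_fst_eq_twelve`). -/
private theorem sum_hopAdj_eq [NeZero L] (p : TorusSite 4 L × Fin 3 × Fin 4) :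
    ∑ q : TorusSite 4 L × Fin 3 × Fin 4, ∑ μ : Fin 4,
      ((if q.1 = Site.shift p.1 μ then (1 : ℝ) else 0) +
        (if p.1 = Site.shift q.1 μ then (1 : ℝ) else 0)) = 96 := by
  calc ∑ q : TorusSite 4 L × Fin 3 × Fin 4, ∑ μ : Fin 4,
        ((if q.1 = Site.shift p.1 μ then (1 : ℝ) else 0) +
          (if p.1 = Site.shift q.1 μ then (1 : ℝ) else 0))
      = ∑ μ : Fin 4, ((∑ q : TorusSite 4 L × Fin 3 × Fin 4,
            if q.1 = Site.shift p.1 μ then (1 : ℝ) else 0) +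
          ∑ q : TorusSite 4 L × Fin 3 × Fin 4, if p.1 = Site.shift q.1 μ then (1 : ℝ) else 0) := by
        rw [Finset.sum_comm]
        simp only [Finset.sum_add_distrib]
    _ = ∑ _μ : Fin 4, (12 + 12 : ℝ) := by
        refine Finset.sum_congr rfl fun μ _ => ?_
        have he : ∀ q : TorusSite 4 L × Fin 3 × Fin 4,
            (p.1 = Site.shift q.1 μ) = (q.1 = p.1 - Pi.single μ 1) :=
          fun q => propext (eq_shift_iff p.1 q.1 μ)
        simp_rw [he]
        rw [sum_ite_fst_eq_twelve, sum_ite_fst_eq_twelve]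
        norm_num
    _ = 96 := by
        simp only [Finset.sum_const, Finset.card_univ, Fintype.card_fin, nsmul_eq_mul]
        norm_num

/-- The nearest-neighbour majorant is symmetric: `N_{pq} = N_{qp}`. -/
private theorem hopAdj_comm (p q : TorusSite 4 L × Fin 3 × Fin 4) :
    (∑ μ : Fin 4, ((if q.1 = Site.shift p.1 μ then (1 : ℝ) else 0) +
        (if p.1 = Site.shift q.1 μ then (1 : ℝ) else 0))) =
      ∑ μ : Fin 4, ((if p.1 = Site.shift q.1 μ then (1 : ℝ) else 0) +
        (if q.1 = Site.shift p.1 μ then (1 : ℝ) else 0)) :=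
  Finset.sum_congr rfl fun _ _ => add_comm _ _

/-- Column sums of the nearest-neighbour majorant: `Σ_p N_{pq} = 96`. -/
private theorem sum_hopAdj_eq' [NeZero L] (q : TorusSite 4 L × Fin 3 × Fin 4) :
    ∑ p : TorusSite 4 L × Fin 3 × Fin 4, ∑ μ : Fin 4,
      ((if q.1 = Site.shift p.1 μ then (1 : ℝ) else 0) +
        (if p.1 = Site.shift q.1 μ then (1 : ℝ) else 0)) = 96 := by
  rw [← sum_hopAdj_eq q]
  exact Finset.sum_congr rfl fun p _ => hopAdj_comm p q

end Hopping

/-! ### The registered statement -/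

/-- **Weighted Schur bounds for the hopping perturbation** (registered stub
`stub_hoppingWeightedBounds` of line `Sketch`, the statement `HoppingWeightedBounds` consumed by
`stub_columnIdentification`).  For an `SU(3)` field `W` with the link-deficit profile
`3 − Re tr W(z,μ) ≤ C_A (d(x,z)+1)² δ²` (`δ ≥ 0`) and `E = D_W(W) − D_W(1)`, with
`C = 9216 (C_A+1)²`: `Σ_q ‖(E v)_q‖² ≤ C δ² Σ_q (d(x,q)+3)² ‖v_q‖²`, the same for `Eᴴ`, and
`Σ_q ‖(Eᴴ v)_q‖ ≤ C δ Σ_q (d(x,q)+3) ‖v_q‖`.  Entry bounds `|E_{pq}|, |E_{qp}| ≤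
(C_A+1) δ (d(x,q)+3) N_{pq}` from `…SmallFieldUltracontractivityBootHopping`, then the weighted
Schur test with the nearest-neighbour majorant `N` (row and column sums `96`). -/
theorem stub_hoppingWeightedBounds :
    ∀ C_A : ℝ, 0 ≤ C_A → ∃ C : ℝ, ∀ (L : ℕ) [NeZero L]
      (W : GaugeConfig 4 L (Matrix.specialUnitaryGroup (Fin 3) ℂ)) (m : ℝ) (x : TorusSite 4 L) (δ : ℝ), 0 ≤ δ →
      (∀ (z : TorusSite 4 L) (μ : Fin 4),
        3 - ((fundamentalRep (Fin 3)) (W (z, μ))).trace.re ≤ C_A * ((torusDist x z : ℝ) + 1) ^ 2 * δ ^ 2) →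
      ∀ v : TorusSite 4 L × Fin 3 × Fin 4 → ℂ,
        (∑ q, ‖((wilsonDirac (fundamentalRep (Fin 3)) W m 1 -
            wilsonDirac (fundamentalRep (Fin 3))
              (fun _ : Edge 4 L => (1 : Matrix.specialUnitaryGroup (Fin 3) ℂ)) m 1).mulVec v) q‖ ^ 2 ≤
          C * δ ^ 2 * ∑ q, ((torusDist x q.1 : ℝ) + 3) ^ 2 * ‖v q‖ ^ 2) ∧
        (∑ q, ‖((wilsonDirac (fundamentalRep (Fin 3)) W m 1 -
            wilsonDirac (fundamentalRep (Fin 3))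
              (fun _ : Edge 4 L => (1 : Matrix.specialUnitaryGroup (Fin 3) ℂ)) m 1)ᴴ.mulVec v) q‖ ^ 2 ≤
          C * δ ^ 2 * ∑ q, ((torusDist x q.1 : ℝ) + 3) ^ 2 * ‖v q‖ ^ 2) ∧
        (∑ q, ‖((wilsonDirac (fundamentalRep (Fin 3)) W m 1 -
            wilsonDirac (fundamentalRep (Fin 3))
              (fun _ : Edge 4 L => (1 : Matrix.specialUnitaryGroup (Fin 3) ℂ)) m 1)ᴴ.mulVec v) q‖ ≤
          C * δ * ∑ q, ((torusDist x q.1 : ℝ) + 3) * ‖v q‖) := by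
  intro C_A hC
  refine ⟨9216 * (C_A + 1) ^ 2, fun L _ W m x δ hδ hdef v => ?_⟩
  -- the nearest-neighbour majorant `N_{pq} = Σ_μ ([q = p+μ̂] + [p = q+μ̂])`
  let N : TorusSite 4 L × Fin 3 × Fin 4 → TorusSite 4 L × Fin 3 × Fin 4 → ℝ := fun p q =>
    ∑ μ : Fin 4, ((if q.1 = Site.shift p.1 μ then (1 : ℝ) else 0) +
      (if p.1 = Site.shift q.1 μ then (1 : ℝ) else 0))
  have hN : ∀ p q, 0 ≤ N p q := fun p q => Finset.sum_nonneg fun μ _ => by positivity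
  have hrow : ∀ p, ∑ q, N p q ≤ 96 := fun p => (sum_hopAdj_eq p).le
  have hcol : ∀ q, ∑ p, N p q ≤ 96 := fun q => (sum_hopAdj_eq' q).le
  -- link smallness and the entry bounds of `E`, `Eᴴ`
  have hc : 0 ≤ (C_A + 1) * δ := by positivity
  have hlink := norm_link_sub_one_le W x hC hδ hdef
  have hE : ∀ p q, ‖(wilsonDirac (fundamentalRep (Fin 3)) W m 1 -
      wilsonDirac (fundamentalRep (Fin 3)) (freeCfg L) m 1) p q‖ ≤
        (C_A + 1) * δ * ((torusDist x q.1 : ℝ) + 3) * N p q :=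
    norm_hopping_apply_le_weight W m x hc hlink
  have hEH : ∀ p q, ‖(wilsonDirac (fundamentalRep (Fin 3)) W m 1 -
      wilsonDirac (fundamentalRep (Fin 3)) (freeCfg L) m 1)ᴴ p q‖ ≤
        (C_A + 1) * δ * ((torusDist x q.1 : ℝ) + 3) * N p q :=
    norm_hopping_conjTranspose_apply_le_weight W m x hc hlink
  -- the weighted Schur test
  have hu : ∀ q : TorusSite 4 L × Fin 3 × Fin 4, 0 ≤ (torusDist x q.1 : ℝ) + 3 := fun q => by
    positivity
  have h1 := schur_sum_norm_sq_mulVec_le _ N (fun q => (torusDist x q.1 : ℝ) + 3) (by norm_num) hN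
    hrow hcol hE v
  have h2 := schur_sum_norm_sq_mulVec_le _ N (fun q => (torusDist x q.1 : ℝ) + 3) (by norm_num) hN
    hrow hcol hEH v
  have h3 := schur_sum_norm_mulVec_le _ N (fun q => (torusDist x q.1 : ℝ) + 3) hc hu hcol hEH v
  have e1 : (96 : ℝ) ^ 2 * ((C_A + 1) * δ) ^ 2 = 9216 * (C_A + 1) ^ 2 * δ ^ 2 := by ring
  rw [e1] at h1 h2
  have hT : 0 ≤ ∑ q : TorusSite 4 L × Fin 3 × Fin 4, ((torusDist x q.1 : ℝ) + 3) * ‖v q‖ :=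
    Finset.sum_nonneg fun q _ => mul_nonneg (hu q) (norm_nonneg _)
  have h96 : 96 * ((C_A + 1) * δ) ≤ 9216 * (C_A + 1) ^ 2 * δ := by nlinarith [mul_nonneg hc hC]
  exact ⟨h1, h2, h3.trans (mul_le_mul_of_nonneg_right h96 hT)⟩

end Summit.QuantumFields.QCD.Cruxes.InterleavedHeatSliceFlow.Sketch

end
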